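import Summits.ValiantsHypothesis.ValiantsHypothesis.Theorems.KPlusLogSqLawTropicalGradedWalkDomMGlue1
import Summits.ValiantsHypothesis.ValiantsHypothesis.Theorems.KPlusLogSqLawTropicalGradedWalkSignsBoundary
import Summits.ValiantsHypothesis.ValiantsHypothesis.Theorems.KPlusLogSqLawTropicalGradedWalkDomTGlue1

/-!
# Route «KPlusLogSqLaw» — GRW-lite (all-`m` `K = 4` family): sign alternation along the LAST PHASE `w = m`

HONEST FRAMING.  Helper file of the chain `--supports` the crux `Summit.ValiantsHypothesis.ValiantsHypothesis.Theses.KPlusLogSqLaw.TropicalB`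
(item `stmt-ValiantsHypothesis-19771`, route `KPlusLogSqLaw`; cell `pub-symmetroid`, seat val-sym-trop-p3 g15, 2026-08-29).  Nothing here bears on
`TropicalB` in its window, `WeakLifting`, the doors, `MatrixDescartes` or `VP ≠ VNP` (census-side construction).

CONTENT.  The Leibniz terms of consecutive states of phase `m = n + 1` of the design (`…GradedWalkDefs`) have opposite signs:
`termSign_boundary_top` (`T(n,n,n) → D(m,0,0)`, the last phase boundary), `termSign_M_turn0` (`D(m,0,0) → D(m,1,0)`), `termSign_M_step`
(`(m,u,t) → (m,u,t+1)`, `t + 1 ≤ u`: one more transposition of the deep-walk cycle; the columns `u − t − 1` and `u` change), `termSign_M_turn`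
(`X(m,u,u) → D(m,u+1,0)` for `1 ≤ u`, including `X(m,n,n) → T(m,m,0)`), `termSign_MT_step` (`T(m,m,t) → T(m,m,t+1)`); with the sign of the
excursion permutation `sign_perm_M` (`(−1)^t`) and small value lemmas of the sign pattern `ee`.
-/

set_option linter.dupNamespace false
set_option autoImplicit false

namespace Summit.ValiantsHypothesis.ValiantsHypothesis.Theorems.LacunarySymmetroidMatrixDescartes.TropicalCensus

namespace GradedWalk

open Summit.ValiantsHypothesis.ValiantsHypothesis.Theorems.MatrixDescartes.Negative

variable (n : ℕ)

/-! ### values of the sign pattern -/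

/-- diagonal cell, class `2`. -/
theorem ee_dg_two {a b : Fin (n + 1)} (h : (a : ℕ) = (b : ℕ)) : ee n a b 2 = -1 := by
  unfold ee; rw [if_neg (by omega), if_pos h]; simp
/-- diagonal cell, class `3`. -/
theorem ee_dg_three {a b : Fin (n + 1)} (h : (a : ℕ) = (b : ℕ)) : ee n a b 3 = 1 := by
  unfold ee; rw [if_neg (by omega), if_pos h]; simp
/-- upper cell, class `1` (connector). -/
theorem ee_up_one {a b : Fin (n + 1)} (h : (a : ℕ) < (b : ℕ)) :
    ee n a b 1 = if (a : ℕ) = 0 then (-1) ^ ((b : ℕ) + 1) else (-1) ^ (b : ℕ) := by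
  unfold ee; rw [if_neg (by omega), if_neg (by omega)]; simp
/-- `(−1)^{(c+1)c} = 1`. -/
theorem neg_one_pow_succ_mul_self (c : ℕ) : (-1 : ℤ) ^ ((c + 1) * c) = 1 := by
  rw [mul_comm]; exact Even.neg_one_pow (Nat.even_mul_succ_self c)

/-! ### the permutations of phase `m`: recursion and sign -/

/-- the swap recursion of the deep-walk cycle. -/
theorem cyc_succ (u t : ℕ) : cyc n u (t + 1) =
    Equiv.swap (⟨(u - (t + 1)) % (n + 1), Nat.mod_lt _ (Nat.succ_pos n)⟩ : Fin (n + 1))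
      ⟨(u - t) % (n + 1), Nat.mod_lt _ (Nat.succ_pos n)⟩ * cyc n u t := rfl

/-- the swap recursion of the excursion permutation of phase `m`. -/
theorem perm_M_succ {u : ℕ} (hun : u ≤ n) (t : ℕ) :
    perm n (n + 1) u (t + 1) =
      Equiv.swap (⟨(u - (t + 1)) % (n + 1), Nat.mod_lt _ (Nat.succ_pos n)⟩ : Fin (n + 1))
        ⟨(u - t) % (n + 1), Nat.mod_lt _ (Nat.succ_pos n)⟩ * perm n (n + 1) u t := by
  unfold perm
  rw [if_neg (show ¬ u = n + 1 by omega), if_neg (show ¬ u = n + 1 by omega), show n + 1 - (n + 1) + u = u by omega, cyc_succ,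
    mul_assoc]

/-- depth `0`: the identity. -/
theorem perm_M_zero (v : ℕ) : perm n (n + 1) v 0 = 1 := by
  unfold perm
  split_ifs
  · exact rot_top n
  · rw [rot_top, mul_one]; rfl

/-- the class map at depth `0`: class `2` below `v`, class `1` from `v` on (`v ≤ m`). -/
theorem lam_M_zero {v : ℕ} (_hv : v ≤ n + 1) (b : Fin (n + 1)) :
    lam n (n + 1) v 0 b = if (b : ℕ) < v then 2 else 1 := by
  have hb : (b : ℕ) ≤ n := Nat.lt_succ_iff.mp b.isLt
  unfold lam
  rw [if_neg (by omega)]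
  by_cases hv' : v = n + 1
  · rw [if_pos hv', if_neg (Nat.not_lt_zero _), if_pos (by omega)]
  · rw [if_neg hv']
    by_cases h1 : (b : ℕ) < v
    · rw [if_pos (by omega), if_pos h1]
    · rw [if_neg (by omega), if_neg h1, if_neg h1]

/-- one more transposition flips the sign (`t + 1 ≤ u ≤ n`). -/
theorem sign_perm_M_succ {u t : ℕ} (htu : t + 1 ≤ u) (hun : u ≤ n) :
    ((Equiv.Perm.sign (perm n (n + 1) u (t + 1)) : ℤˣ) : ℤ) = -((Equiv.Perm.sign (perm n (n + 1) u t) : ℤˣ) : ℤ) := by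
  have hne : (⟨(u - (t + 1)) % (n + 1), Nat.mod_lt _ (Nat.succ_pos n)⟩ : Fin (n + 1)) ≠
      ⟨(u - t) % (n + 1), Nat.mod_lt _ (Nat.succ_pos n)⟩ := by
    intro h
    have h' := congrArg Fin.val h
    dsimp only at h'
    rw [Nat.mod_eq_of_lt (by omega), Nat.mod_eq_of_lt (by omega)] at h'
    omega
  rw [perm_M_succ n hun t, Equiv.Perm.sign_mul, Equiv.Perm.sign_swap hne]
  simp

/-- the sign of the excursion permutation of depth `t` is `(−1)^t`. -/
theorem sign_perm_M {u : ℕ} (hun : u ≤ n) : ∀ t : ℕ, t ≤ u →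
    ((Equiv.Perm.sign (perm n (n + 1) u t) : ℤˣ) : ℤ) = (-1) ^ t
  | 0, _ => by rw [perm_M_zero, Equiv.Perm.sign_one]; simp
  | t + 1, ht => by rw [sign_perm_M_succ n ht hun, sign_perm_M hun t (by omega), pow_succ]; ring

/-- off the columns `u − t − 1` and `u` the permutations of depths `t`, `t + 1` agree. -/
theorem perm_M_succ_eq {u t : ℕ} (htu : t + 1 ≤ u) (hun : u ≤ n) (b : Fin (n + 1)) (h1 : (b : ℕ) ≠ u - (t + 1))
    (h2 : (b : ℕ) ≠ u) : perm n (n + 1) u (t + 1) b = perm n (n + 1) u t b := by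
  apply Fin.ext
  rw [perm_M_val n hun (by omega), perm_M_val n hun (by omega)]
  split_ifs <;> omega

/-- off the column `u − t − 1` the class maps of depths `t`, `t + 1` agree. -/
theorem lam_M_succ_eq {u t : ℕ} (htu : t + 1 ≤ u) (hun : u ≤ n) (b : Fin (n + 1)) (h1 : (b : ℕ) ≠ u - (t + 1)) :
    lam n (n + 1) u (t + 1) b = lam n (n + 1) u t b := by
  rw [lam_M n hun, lam_M n hun]
  by_cases c1 : (b : ℕ) + (t + 1) < u
  · rw [if_pos c1, if_pos (by omega)]
  · have c2 : ¬ (b : ℕ) + t < u := by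
      intro h; apply h1; omega
    rw [if_neg c1, if_neg c2]

/-! ### transitions of phase `m` -/

/-- `(m,u,t) → (m,u,t+1)` (`t + 1 ≤ u ≤ n`; for `t = 0` this is `D(m,u,0) → X(m,u,1)`). -/
theorem termSign_M_step (u t : ℕ) (htu : t + 1 ≤ u) (hun : u ≤ n) :
    termSign (ee n) (cterm n (n + 1) u t) * termSign (ee n) (cterm n (n + 1) u (t + 1)) < 0 := by
  unfold cterm
  rw [termSign_mul_termSign, sign_perm_M_succ n htu hun, mul_neg, ShiftThree.sign_mul_self]
  have hcu : (⟨u - (t + 1), by omega⟩ : Fin (n + 1)) ≠ ⟨u, by omega⟩ := by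
    intro h; have := congrArg Fin.val h; simp only at this; omega
  rw [Finset.prod_eq_mul _ _ hcu]
  · -- the two changing columns
    have hp1 : perm n (n + 1) u t ⟨u - (t + 1), by omega⟩ = ⟨u - (t + 1), by omega⟩ :=
      perm_M_fix n hun (by omega) (Or.inl (by simp only; omega))
    have hp1' : ((perm n (n + 1) u (t + 1) ⟨u - (t + 1), by omega⟩ : Fin (n + 1)) : ℕ) = u - (t + 1) + 1 :=
      perm_M_blk n hun htu (by simp only; omega) (by simp only; omega)
    have hl1 : lam n (n + 1) u t ⟨u - (t + 1), by omega⟩ = 2 := by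
      rw [lam_M n hun, if_pos (by simp only; omega)]
    have hl1' : lam n (n + 1) u (t + 1) ⟨u - (t + 1), by omega⟩ = 3 := by
      rw [lam_M n hun, if_neg (by simp only; omega), if_pos (by simp only; omega)]
    have hp2 : ((perm n (n + 1) u t ⟨u, by omega⟩ : Fin (n + 1)) : ℕ) = u - t := perm_M_conn n hun (by omega) rfl
    have hp2' : ((perm n (n + 1) u (t + 1) ⟨u, by omega⟩ : Fin (n + 1)) : ℕ) = u - (t + 1) := perm_M_conn n hun htu rfl
    have hl2 : lam n (n + 1) u t ⟨u, by omega⟩ = 1 := by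
      rw [lam_M n hun, if_neg (by simp only; omega), if_neg (by simp only; omega)]
    have hl2' : lam n (n + 1) u (t + 1) ⟨u, by omega⟩ = 1 := by
      rw [lam_M n hun, if_neg (by simp only; omega), if_neg (by simp only; omega)]
    have hlow1 : ((⟨u - (t + 1), by omega⟩ : Fin (n + 1)) : ℕ) <
        ((perm n (n + 1) u (t + 1) ⟨u - (t + 1), by omega⟩ : Fin (n + 1)) : ℕ) := by
      rw [hp1']; simp only; omega
    have hXu : ee n (perm n (n + 1) u t ⟨u, by omega⟩) ⟨u, by omega⟩ 1 = (-1) ^ u := by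
      rcases Nat.eq_zero_or_pos t with ht0 | ht0
      · subst ht0
        rw [ee_diag_one n (by rw [hp2]; simp only; omega)]
      · rw [ee_up_one n (by rw [hp2]; simp only; omega), hp2, if_neg (by omega)]
    have hup2 : ((perm n (n + 1) u (t + 1) ⟨u, by omega⟩ : Fin (n + 1)) : ℕ) < ((⟨u, by omega⟩ : Fin (n + 1)) : ℕ) := by
      rw [hp2']; simp only; omega
    rw [hp1, hl1, hl1', hl2, hl2', ee_dg_two n rfl, ee_low_three n hlow1, hp1', hXu, ee_up_one n hup2, hp2']
    simp only
    rw [neg_one_pow_succ_mul_self]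
    rcases neg_one_pow_eq_or ℤ u with hx | hx
    · rw [pow_succ, hx]
      split_ifs <;> norm_num
    · rw [pow_succ, hx]
      split_ifs <;> norm_num
  · intro b _ hb
    obtain ⟨hb1, hb2⟩ := hb
    have hb1' : (b : ℕ) ≠ u - (t + 1) := fun h => hb1 (Fin.ext (by simp only; omega))
    have hb2' : (b : ℕ) ≠ u := fun h => hb2 (Fin.ext (by simp only; omega))
    rw [perm_M_succ_eq n htu hun b hb1' hb2', lam_M_succ_eq n htu hun b hb1']
    exact ee_mul_self n (present_MX n u t (by omega) hun b)
  · intro h; exact absurd (Finset.mem_univ _) h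
  · intro h; exact absurd (Finset.mem_univ _) h

/-- `D(m,0,0) → D(m,1,0)` (`1 ≤ n`): column `0` switches from class `1` to class `2`. -/
theorem termSign_M_turn0 (hn : 1 ≤ n) :
    termSign (ee n) (cterm n (n + 1) 0 0) * termSign (ee n) (cterm n (n + 1) 1 0) < 0 := by
  unfold cterm
  rw [termSign_mul_termSign, perm_M_zero, perm_M_zero, Equiv.Perm.sign_one]
  simp only [Units.val_one, one_mul, Equiv.Perm.coe_one, id_eq]
  rw [Finset.prod_eq_single (⟨0, by omega⟩ : Fin (n + 1))]
  · rw [lam_M_zero n (by omega), lam_M_zero n (by omega), if_neg (by simp), if_pos (by simp),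
      ee_diag_one n rfl, ee_dg_two n rfl]
    simp
  · intro b _ hb
    have hb0 : (b : ℕ) ≠ 0 := fun h => hb (Fin.ext h)
    rw [lam_M_zero n (by omega), lam_M_zero n (by omega), if_neg (by omega), if_neg (by omega)]
    exact ee_mul_self n (ee_diag_ne n rfl 1 (by decide))
  · intro h; exact absurd (Finset.mem_univ _) h

/-- `X(m,u,u) → D(m,u+1,0)` (`1 ≤ u ≤ n`; for `u = n` the second state is the top state `T(m,m,0)`). -/
theorem termSign_M_turn (u : ℕ) (hu1 : 1 ≤ u) (hun : u ≤ n) :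
    termSign (ee n) (cterm n (n + 1) u u) * termSign (ee n) (cterm n (n + 1) (u + 1) 0) < 0 := by
  unfold cterm
  rw [termSign_mul_termSign, sign_perm_M n hun u le_rfl, perm_M_zero, Equiv.Perm.sign_one]
  simp only [Units.val_one, mul_one, Equiv.Perm.coe_one, id_eq]
  have h0u : (⟨0, by omega⟩ : Fin (n + 1)) ≠ ⟨u, by omega⟩ := by
    intro h; have := congrArg Fin.val h; simp only at this; omega
  rw [Finset.prod_eq_mul _ _ h0u]
  · have hp0 : ((perm n (n + 1) u u ⟨0, by omega⟩ : Fin (n + 1)) : ℕ) = 0 + 1 :=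
      perm_M_blk n hun le_rfl (by simp only; omega) (by simp only; omega)
    have hpu : ((perm n (n + 1) u u ⟨u, by omega⟩ : Fin (n + 1)) : ℕ) = u - u := perm_M_conn n hun le_rfl rfl
    have hl0 : lam n (n + 1) u u ⟨0, by omega⟩ = 3 := by
      rw [lam_M n hun, if_neg (by simp only; omega), if_pos (by simp only; omega)]
    have hlu : lam n (n + 1) u u ⟨u, by omega⟩ = 1 := by
      rw [lam_M n hun, if_neg (by simp only; omega), if_neg (by simp only; omega)]
    have hlow0 : ((⟨0, by omega⟩ : Fin (n + 1)) : ℕ) < ((perm n (n + 1) u u ⟨0, by omega⟩ : Fin (n + 1)) : ℕ) := by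
      rw [hp0]; simp only; omega
    have hupu : ((perm n (n + 1) u u ⟨u, by omega⟩ : Fin (n + 1)) : ℕ) < ((⟨u, by omega⟩ : Fin (n + 1)) : ℕ) := by
      rw [hpu]; simp only; omega
    rw [hl0, hlu, lam_M_zero n (by omega), lam_M_zero n (by omega), ee_low_three n hlow0, hp0, ee_up_one n hupu, hpu,
      if_pos (show ((⟨0, by omega⟩ : Fin (n + 1)) : ℕ) < u + 1 by simp only; omega),
      if_pos (show ((⟨u, by omega⟩ : Fin (n + 1)) : ℕ) < u + 1 by simp only; omega),
      ee_dg_two n rfl, ee_dg_two n rfl]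
    simp only [Nat.sub_self, mul_zero, pow_zero]
    rcases neg_one_pow_eq_or ℤ u with hx | hx
    · rw [pow_succ, hx]; norm_num
    · rw [pow_succ, hx]; norm_num
  · intro b _ hb
    obtain ⟨hb1, hb2⟩ := hb
    have hb1' : (b : ℕ) ≠ 0 := fun h => hb1 (Fin.ext (by simp only; omega))
    have hb2' : (b : ℕ) ≠ u := fun h => hb2 (Fin.ext (by simp only; omega))
    rcases Nat.lt_or_ge (b : ℕ) u with hbu | hbu
    · -- block column: `(b+1, b, 3)` against the class-`2` diagonal cell
      have hpb : ((perm n (n + 1) u u b : Fin (n + 1)) : ℕ) = (b : ℕ) + 1 := perm_M_blk n hun le_rfl (by omega) hbu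
      have hlowb : (b : ℕ) < ((perm n (n + 1) u u b : Fin (n + 1)) : ℕ) := by rw [hpb]; omega
      rw [lam_M n hun, if_neg (by omega), if_pos hbu, lam_M_zero n (by omega), if_pos (by omega), ee_low_three n hlowb, hpb,
        ee_dg_two n rfl, neg_one_pow_succ_mul_self, if_neg hb1']
      norm_num
    · -- diagonal class-`1` column of both states
      rw [perm_M_fix n hun le_rfl (Or.inr (by omega)), lam_M n hun, if_neg (by omega), if_neg (by omega),
        lam_M_zero n (by omega), if_neg (by omega)]
      exact ee_mul_self n (ee_diag_ne n rfl 1 (by decide))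
  · intro h; exact absurd (Finset.mem_univ _) h
  · intro h; exact absurd (Finset.mem_univ _) h

/-- `T(m,m,t) → T(m,m,t+1)` (`t ≤ n`): column `t` switches from class `2` to class `3`. -/
theorem termSign_MT_step (t : ℕ) (htn : t ≤ n) :
    termSign (ee n) (cterm n (n + 1) (n + 1) t) * termSign (ee n) (cterm n (n + 1) (n + 1) (t + 1)) < 0 := by
  unfold cterm
  rw [perm_T n (n + 1) t, perm_T n (n + 1) (t + 1), rot_top, termSign_mul_termSign, Equiv.Perm.sign_one]
  simp only [Units.val_one, one_mul, Equiv.Perm.coe_one, id_eq]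
  rw [Finset.prod_eq_single (⟨t, by omega⟩ : Fin (n + 1))]
  · rw [lam_MT, lam_MT, if_neg (show ¬ ((⟨t, by omega⟩ : Fin (n + 1)) : ℕ) < t by simp),
      if_pos (show ((⟨t, by omega⟩ : Fin (n + 1)) : ℕ) < t + 1 by simp), ee_dg_two n rfl, ee_dg_three n rfl]
    norm_num
  · intro b _ hb
    have hbt : (b : ℕ) ≠ t := fun h => hb (Fin.ext h)
    have hl : lam n (n + 1) (n + 1) (t + 1) b = lam n (n + 1) (n + 1) t b := by
      rw [lam_MT, lam_MT]
      by_cases h1 : (b : ℕ) < t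
      · rw [if_pos (by omega), if_pos h1]
      · rw [if_neg (by omega), if_neg h1]
    rw [hl]
    exact ee_mul_self n (ee_diag_ne n rfl _ (by rw [lam_MT]; split_ifs <;> decide))
  · intro h; exact absurd (Finset.mem_univ _) h

/-- `zsign` at the top is `1`. -/
theorem zsign_top : zsign n (n + 1) = 1 := by
  unfold zsign; rw [← two_mul]; exact Even.neg_one_pow ⟨_, two_mul _⟩

/-- the sign bookkeeping of a column at the last phase boundary `T(n,n,n) → D(m,0,0)` (`1 ≤ n`). -/
theorem boundary_top_column (hn : 1 ≤ n) (b : Fin (n + 1)) :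
    ee n (rot n n b) b (lam n n n n b) * ee n (rot n (n + 1) b) b (lam n (n + 1) 0 0 b) =
      (if (b : ℕ) = 0 then (1 : ℤ) else if (b : ℕ) < n then -((-1) ^ (b : ℕ)) else zsign n n * (-1) ^ n) := by
  have hb : (b : ℕ) ≤ n := Nat.lt_succ_iff.mp b.isLt
  have hr2 : ((rot n (n + 1) b : Fin (n + 1)) : ℕ) = (b : ℕ) := by rw [rot_val_blk n le_rfl b b.isLt]; omega
  rw [lam_T, lam_D n (Nat.succ_pos n), if_neg (show ¬ (n + 1 ≤ (b : ℕ)) by omega), if_neg (Nat.not_lt_zero _),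
    ee_diag_one n hr2]
  rcases Nat.lt_or_ge (b : ℕ) n with hbn | hbn
  · have hr1 := rot_val_blk n (Nat.le_succ n) b hbn
    have hl1 : (b : ℕ) < ((rot n n b : Fin (n + 1)) : ℕ) := by rw [hr1]; omega
    rw [if_neg (by omega), if_pos hbn, ee_low_three n hl1, hr1, show (b : ℕ) + (n + 1 - n) = (b : ℕ) + 1 by omega,
      neg_one_pow_succ_mul_self]
    by_cases hb0 : (b : ℕ) = 0
    · rw [if_pos hb0, if_pos hb0, hb0]; simp
    · rw [if_neg hb0, if_neg hb0, if_pos hbn]; simp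
  · have hbn' : (b : ℕ) = n := by omega
    have hr1 := rot_val_wrap n (Nat.le_succ n) b hbn
    have hup : ((rot n n b : Fin (n + 1)) : ℕ) < (b : ℕ) := by rw [hr1]; omega
    rw [if_pos hbn, ee_up_zero n hup, hr1, if_pos (by omega), if_neg (by omega), if_neg (by omega), hbn']

/-- **the last phase boundary**: the terms of `T(n,n,n)` and `D(m,0,0)` have opposite signs (`1 ≤ n`). -/
theorem termSign_boundary_top (hn : 1 ≤ n) :
    termSign (ee n) (cterm n n n n) * termSign (ee n) (cterm n (n + 1) 0 0) < 0 := by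
  obtain ⟨k, rfl⟩ : ∃ k, n = k + 1 := ⟨n - 1, by omega⟩
  unfold cterm
  rw [perm_T, perm_D (k + 1) (show 0 ≠ k + 1 + 1 by omega), termSign_mul_termSign, sign_rot_mul_sign_rot_succ (k + 1) (k + 1) le_rfl]
  rw [Finset.prod_congr rfl (fun b _ => boundary_top_column (k + 1) hn b)]
  rw [Fin.prod_univ_eq_prod_range (fun i => if i = 0 then (1 : ℤ) else if i < k + 1 then -((-1) ^ i)
      else zsign (k + 1) (k + 1) * (-1) ^ (k + 1)) (k + 1 + 1)]
  rw [Finset.prod_range_succ]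
  have hhead : ∏ i ∈ Finset.range (k + 1), (if i = 0 then (1 : ℤ) else if i < k + 1 then -((-1) ^ i)
      else zsign (k + 1) (k + 1) * (-1) ^ (k + 1)) = ∏ i ∈ Finset.range (k + 1), (if i = 0 then (1 : ℤ) else -((-1) ^ i)) := by
    refine Finset.prod_congr rfl fun i hi => ?_
    rw [Finset.mem_range] at hi
    by_cases hi0 : i = 0
    · rw [if_pos hi0, if_pos hi0]
    · rw [if_neg hi0, if_neg hi0, if_pos hi]
  rw [hhead, prod_bdh, if_neg (show k + 1 ≠ 0 by omega), if_neg (lt_irrefl _)]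
  set S := ∑ i ∈ Finset.range (k + 1), i with hS
  have hz := zsign_mul_zsign_succ (k + 1) (k + 1)
  rw [zsign_top, mul_one, zstep_eq (k + 1) (k + 1) (by omega), ← hS] at hz
  rw [hz, ← pow_add, ← pow_add, ← pow_add]
  have hodd : Odd (k + 1 + (S + k + (k + 1 + 1 + (k + 1) + 1 + (k + 1) * (k + 1) + S + (k + 1)))) := by
    rcases Nat.even_or_odd k with ⟨j, hj⟩ | ⟨j, hj⟩
    · subst hj; exact ⟨S + 2 * j * j + 7 * j + 3, by ring⟩
    · subst hj; exact ⟨S + 2 * j * j + 9 * j + 7, by ring⟩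
  rw [Odd.neg_one_pow hodd]
  norm_num

end GradedWalk

end Summit.ValiantsHypothesis.ValiantsHypothesis.Theorems.LacunarySymmetroidMatrixDescartes.TropicalCensus
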